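import Mathlib
import HarnessLib
import Summits.HubbardSuperconductivity.HubbardSuperconductivity.Theorems.KLProgrammeKLRegimeEngineScaleZeroE4PackageDoors
import Summits.HubbardSuperconductivity.HubbardSuperconductivity.Theorems.KLProgrammeKLRegimeEngineScaleZeroAssembly

/-!
# K3 ENGINE child (`KLRegimeEngineV17F2`, stmt-HubbardSuperconductivity-20437), stub (a) `stub_engine_scale0`: the FIVE-CLAUSE SCALE-`0` RUNG
# (V10 currency) UNCONDITIONAL under the doors `klEngC₃6`/`klEngU₀6`, for every well-formed `G` with `E ≤ G.cE4`, `klIsoT⁴ ≤ G.CF`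

Cell `gate-hubbard-kl`, seat p4 (g9).  p3 g6's `engineScaleZero_klEngQ5_of` (…ScaleZeroAssembly) gives the five clauses (E1-v4)₀ `KernelNormsV4`,
(E2-v9)₀ `PairLadderStepAtV9`, (E2′-S2 uv)₀ `QuarticValueUVAtS2`, (E4)₀ `EngineFirstMoments`, (E5-S)₀ `IsoTupleL1AtS` at `(G, klEngQ5 P R)` MODULO (E4)₀
and the isotropic torus bound; (E5)'s bound is p4 g7's `isoTorusBoundAt_klIsoT`, and (E4)₀ is now p4 g9's `exists_engineFirstMoments_zero_of_doors`
(…E4PackageDoors) under the doors of `…EngineV8DefsU6`.  Composition: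

* **`exists_engineScaleZero_of_doors`** — `∃ E ≥ 0, ∀ G, G.WF → E ≤ G.cE4 → klIsoT ^ 4 ≤ G.CF → ∀ P R c, P.WF → R.WF2 → 0 < c → c ≤ klEngC₃6 P R →
  ∀ μ ∈ klWindowC, ∀ U, 0 < U → U ≤ klEngU₀6 P R c → ∀ β, klBetaMin ≤ β → β ≤ e^{c/U²} → ∀ K, FrameOK R U (nScales β) μ K → ∀ L M, klEngL₃ β U ≤ L →
  klEngM₃ β U L ≤ M →` the five clauses at `(G, klEngQ5 P R)` — NO model hypothesis left; `E` is `R`-free (the (E4)₀ constant).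

The engine-flow registration package `klEngGeo7` (…EngineV8DefsG7) is one such `G`; the V17F2-currency reading at `n = 0` (`K₀ = 0`) is k3c2-p1's
`…ScaleZeroV17F`.  Everything is proved; no definitions, no named facts, no sorry.  Nothing asserts superconductivity.
-/

noncomputable section

namespace Summit.HubbardSuperconductivity.HubbardSuperconductivity.Theorems.EngineV8

set_option linter.dupNamespace false -- summit = problem name (single-conjunct summit), D-0017

open Real Finset Literature.MathematicalPhysics.QuantumLattice Literature.Probability.LatticeModels
open Summit.HubbardSuperconductivity.HubbardSuperconductivity.Theorems.KLRegimeSplit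
open Summit.HubbardSuperconductivity.HubbardSuperconductivity.Theorems.KLProgrammeLegKernels
open scoped ComplexConjugate

/-- **The five-clause scale-`0` rung (V10 currency), unconditional under the doors**: see the module docstring. -/
theorem exists_engineScaleZero_of_doors :
    ∃ E : ℝ, 0 ≤ E ∧ ∀ (G : GeoConsts), G.WF → E ≤ G.cE4 → klIsoT ^ 4 ≤ G.CF →
      ∀ (P : SplitConsts) (R : RenConsts) (c : ℝ), P.WF → R.WF2 → 0 < c → c ≤ klEngC₃6 P R →
      ∀ μ ∈ klWindowC, ∀ U : ℝ, 0 < U → U ≤ klEngU₀6 P R c →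
      ∀ β : ℝ, klBetaMin ≤ β → β ≤ Real.exp (c / U ^ 2) → ∀ K : TrigPolyC4v, FrameOK R U (nScales β) μ K →
      ∀ (L M : ℕ) [NeZero L] [NeZero M], klEngL₃ β U ≤ L → klEngM₃ β U L ≤ M →
        KernelNormsV4 L M P (klEngQ5 P R) β U μ K 0 ∧ PairLadderStepAtV9 L M G P (klEngQ5 P R) β U μ K 0 ∧
          QuarticValueUVAtS2 L M G P (klEngQ5 P R) β U μ K 0 ∧ EngineFirstMoments L M G P (klEngQ5 P R) β U μ K 0 ∧
            IsoTupleL1AtS L M G P β U μ K 0 := by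
  obtain ⟨E, hE0, hE4⟩ := exists_engineFirstMoments_zero_of_doors
  obtain ⟨T₀, hT₀0, hT₀⟩ := TorusFourierL2.exists_isoTorusBoundAt
  have hIso := isoTorusBoundAt_klIsoT hT₀0 hT₀
  refine ⟨E, hE0, ?_⟩
  intro G hG hGE hCF P R c hP hR hc hc6 μ hμ U hU hU6 β hβ hβc K hK L M _ _ hL hM
  have hc3 : c ≤ klEngC₃3 P R := hc6.trans (klEngC₃6_le_klEngC₃3 P R)
  have hcD : c ≤ klE4C₃ R := hc6.trans (klEngC₃6_le_klE4C₃ P R)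
  have hU3 : U ≤ klEngU₀3 P R c := hU6.trans (klEngU₀6_le_klEngU₀3 P R c)
  have hUD : U ≤ klE4U₀ R := hU6.trans (klEngU₀6_le_klE4U₀ P R c)
  have h4 := hE4 G P R (klEngQ5 P R) hGE le_rfl c hP hR hc hc3 hcD μ hμ U hU hU3 hUD β hβ hβc K hK L M hL hM
  exact engineScaleZero_klEngQ5_of G hG P R c hP hR hc hc3 μ hμ U hU hU3 β hβ hβc K hK L M hL hM h4 klIsoT_nonneg
    (fun m ω c' => hIso P R c hP hR hc hc3 μ hμ U hU hU3 β hβ hβc K hK L M hL hM m ω c') hCF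

end Summit.HubbardSuperconductivity.HubbardSuperconductivity.Theorems.EngineV8

end
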